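import Mathlib
import HarnessLib

/-!
# Route `RadicialJung`, crux `CleanModels` (stmt-ResolutionOfSingularities-15917), line `Sketch` rev 35, stub 6 `stub_cleanProp44` (X44c),
# `τ = 1` residual (R1)–(R3): THE DEGREE COUNT OF THE δ-DESCENT ALONG BIRTH CHAINS (algebraic core of memo 4e §2.5 / §2.6 (c))

Seat decomp-res-hand-2 g12 (structural hand, stubs 5–7).  After hand-2 g11 the kernel census of stub 6 (X44c) is
✓ `cleanProp44_of_tauOneResidual : hphaseTwo → htauOne → hcurveTauOne → X44c` (`…CleanProp44OfTauOneResidual.lean`): everything left lives at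
the `τ = 1` points of [CoP1] Prop. 4.4, where the point blow-ups INSERTED to make a maximal-order curve clean-permissible (L7b) can create new
maximal-order curves whose own insertions create new «tracked leaf germs» — the BIRTHS of memo
`Cruxes/CleanModels/Lines/Sketch-memo-4e-cleanPermissible.md` §2.4.  The one termination statement of X44c that is not in print is (B′) «no
infinite chain of births»; memo 4e §2.5 settles it by hand for perfect residue fields and §2.6 (c) for every residue field outside the corner
`λ' ≡ 0` ((B5′), open), by a δ-DESCENT whose engine is a degree count for a polynomial `λ ∈ κ(c)[u]` on the created curve `Γ'' ≅ ℙ¹_{κ(c)}`.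

This file kernel-checks that engine, with NO scheme theory (the companion of ✓ `…CornerChains.lean`, which did the same for memo 4e (4′)):

DICTIONARY (informal, for the reader, memo 4e §2.5–2.6; NOT formalized here).  At a birth `c` with `δ := δ(c, L_rep) ∈ pℤ` the near successor
`Γ'' ⊂ E_{Z_{δ−2}}` is the graph of a polynomial `λ ∈ κ(c)[u]` of degree `≤ δ` (the solvable `δ`-face `C_μ (T + Λ)^μ`, `Λ = U₁^δ λ(U₂/U₁)`), the
unit presentation restricts to `F := U|_{Γ''} = −v(c)·λ`, and a closed point `c' ∈ Γ'' ∖ {∞}` — an irreducible `π ∈ κ(c)[u]` — is a birth iff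
`2 ≤ ν(c') < ∞`, `ν(c') := sup_G ord_π (F − G^p)` (distance of `F` to `p`-th powers); the restriction argument gives `δ*(c') ≤ ν(c')`.
THE DESCENT is then the following algebra, proved below for an arbitrary field (indeed commutative ring) of characteristic `p`:

* §1 `births_pow_dvd_derivative_of_pow_succ_dvd_sub_pow`: `π^{k+1} ∣ F − G^p ⟹ π^k ∣ F'` (a derivation kills `p`-th powers and lowers
  `π`-adic orders by at most one — at EVERY closed point, separable or not); hence `ν(c') ≤ 1 + ord_{c'} F'`
  (`births_le_of_pow_dvd_sub_pow_of_not_dvd`).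
* §2 `births_natDegree_derivative_le`: `p ∣ δ`, `deg F ≤ δ ⟹ deg F' ≤ δ − 2` (the coefficient of `u^{δ−1}` in `F'` is `δ·F_δ = 0`).
* §3 `births_sum_mul_natDegree_le_natDegree`: pairwise coprime `π_i` with `π_i^{k_i} ∣ H ≠ 0 ⟹ Σ k_i deg π_i ≤ deg H`.
* §4 THE COUNT `births_weighted_count_le`: if `F' ≠ 0` (i.e. `λ ∉ κ(c)[u^p]`, the complement of the corner (B5′)), then over any family of pairwise
  coprime `π_i` with `π_i^{n_i} ∣ F − G_i^p`:  `Σ_i (n_i − 1)·deg π_i ≤ δ − 2`.  Corollaries: every birth has `ν(c') ≤ δ − 1 < δ`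
  (`births_lt_of_pow_dvd_sub_pow` — the descent `δ*(c') < δ*(c)`), and the births number at most `δ − 2` counted with residue degrees
  (`births_card_le`).
* §5 the (B2) count on a near LINE `ℓ_x ⊂ E_x` (memo 4e §2.4 (B2)): for `r` linear forms `l_i = β_i u + γ_i` and exponents `a_i ≥ 1` with
  `p ∣ Σ a_i`, `(∏ l_i^{a_i})' = N · ∏ l_i^{a_i − 1}` with `deg N ≤ r − 2` (`births_derivative_prod_linear_pow`, `births_natDegree_logNumerator_le`):
  the unit monomial `U|_ℓ = u(x) ∏ l_i^{a_i}` has at most `r − 2` `W`-tangency points off the sides — none over `r ≤ 2` charged components.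

Honest framing: OURS, elementary commutative algebra (`Polynomial.derivative`); it supports the termination analysis of the research residual of
stub 6 and closes nothing: the dictionary above, (B5′), the three hypotheses of `cleanProp44_of_tauOneResidual`, X44c, every case of `CleanModels`
and resolution of singularities in characteristic `p` are NOT proved here.  References for the setting only:
[cite: CossartPiltant2008, Lemma 4.3 (5), Prop. 4.4] [cite: CossartJannsenSaito2020, Lemma 5.25, Thm. 6.28 (Step 1), Rem. 6.29].
-/

set_option linter.dupNamespace false -- mandated namespace of this single-conjunct summit

open Polynomial Finset

namespace Summit.ResolutionOfSingularities.ResolutionOfSingularities.Theorems.RadicialJung.CleanModels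

/-! ## §1 A derivation kills `p`-th powers and lowers `π`-adic orders by at most one -/

/-- If `π^{k+1}` divides `F` then `π^k` divides `F'` (Leibniz: `(π^{k+1} w)' = π^k((k+1)π' w + π w')`); no hypothesis on `π`. [folklore] -/
theorem births_pow_dvd_derivative_of_pow_succ_dvd {R : Type*} [CommRing R] {π F : R[X]} {k : ℕ}
    (h : π ^ (k + 1) ∣ F) : π ^ k ∣ derivative F := by
  obtain ⟨w, rfl⟩ := h
  rw [derivative_mul, derivative_pow_succ]
  refine dvd_add ?_ ?_
  · exact Dvd.dvd.mul_right (Dvd.dvd.mul_right (Dvd.intro_left _ rfl) _) _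
  · exact Dvd.dvd.mul_right (pow_dvd_pow π (Nat.le_succ k)) _

/-- In characteristic `p` the derivative of a `p`-th power vanishes. [folklore] -/
theorem births_derivative_pow_char_eq_zero {R : Type*} [CommRing R] (p : ℕ) [CharP R p] (G : R[X]) :
    derivative (G ^ p) = 0 := by
  rw [derivative_pow, CharP.cast_eq_zero R p, map_zero, zero_mul, zero_mul]

/-- **`π^{k+1} ∣ F − G^p ⟹ π^k ∣ F'`** in characteristic `p`: the distance of `F` to `p`-th powers at a closed point is at most one more than the
order of `F'` there (memo 4e §2.6 (c): «the derivation `d/du` kills `p`-th powers and constants and does not lower `π`-adic orders by more than one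
at ANY closed point»). [folklore] -/
theorem births_pow_dvd_derivative_of_pow_succ_dvd_sub_pow {R : Type*} [CommRing R] (p : ℕ) [CharP R p]
    {π F G : R[X]} {k : ℕ} (h : π ^ (k + 1) ∣ F - G ^ p) : π ^ k ∣ derivative F := by
  have h' := births_pow_dvd_derivative_of_pow_succ_dvd h
  rwa [derivative_sub, births_derivative_pow_char_eq_zero p G, sub_zero] at h'

/-- The same with an added `p`-th power: `π^{k+1} ∣ F + G^p ⟹ π^k ∣ F'`. [folklore] -/
theorem births_pow_dvd_derivative_of_pow_succ_dvd_add_pow {R : Type*} [CommRing R] (p : ℕ) [CharP R p]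
    {π F G : R[X]} {k : ℕ} (h : π ^ (k + 1) ∣ F + G ^ p) : π ^ k ∣ derivative F := by
  have h' := births_pow_dvd_derivative_of_pow_succ_dvd h
  rwa [derivative_add, births_derivative_pow_char_eq_zero p G, add_zero] at h'

/-- **`ν(c') ≤ 1 + ord_{c'} F'`** in divisibility form: if `π^n ∣ F − G^p` and `π^m ∤ F'` then `n ≤ m`. [folklore] -/
theorem births_le_of_pow_dvd_sub_pow_of_not_dvd {R : Type*} [CommRing R] (p : ℕ) [CharP R p]
    {π F G : R[X]} {n m : ℕ} (hn : π ^ n ∣ F - G ^ p) (hm : ¬ π ^ m ∣ derivative F) : n ≤ m := by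
  rcases le_or_gt n m with h | hlt
  · exact h
  · exfalso
    obtain ⟨k, rfl⟩ : ∃ k, n = k + 1 := ⟨n - 1, by omega⟩
    exact hm ((pow_dvd_pow π (by omega : m ≤ k)).trans (births_pow_dvd_derivative_of_pow_succ_dvd_sub_pow p hn))

/-! ## §2 The degree of the derivative drops by two when `p` divides the degree bound -/

/-- **`p ∣ δ`, `deg F ≤ δ ⟹ deg F' ≤ δ − 2`**: the coefficient of `u^{δ−1}` in `F'` is `δ · F_δ = 0` in characteristic `p` (memo 4e §2.5 DEGREE
COUNT: «the coefficient of `u^{δ−1}` in `λ'` is `δ·λ_δ = 0` because `p | δ`»). [folklore] -/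
theorem births_natDegree_derivative_le {R : Type*} [Semiring R] (p : ℕ) [CharP R p] {δ : ℕ} (hδ : p ∣ δ)
    {F : R[X]} (hF : F.natDegree ≤ δ) : (derivative F).natDegree ≤ δ - 2 := by
  rw [natDegree_le_iff_coeff_eq_zero]
  intro N hN
  rw [coeff_derivative]
  by_cases h : δ < N + 1
  · rw [coeff_eq_zero_of_natDegree_lt (lt_of_le_of_lt hF h), zero_mul]
  · have hN1 : N + 1 = δ := by omega
    have hcast : ((N : R) + 1) = ((δ : ℕ) : R) := by rw [← hN1, Nat.cast_succ]
    rw [hcast, (CharP.cast_eq_zero_iff R p δ).mpr hδ, mul_zero]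

/-- Under the hypotheses of the count, `2 ≤ δ`: `deg F ≤ δ ≤ 1` and `p ∣ δ` with `p ≠ 1` force `δ = 0`, and a constant has zero derivative.
[folklore] -/
theorem births_two_le_of_derivative_ne_zero {R : Type*} [Semiring R] (p : ℕ) [CharP R p] {δ : ℕ} (hδ : p ∣ δ)
    {F : R[X]} (hF : F.natDegree ≤ δ) (hF' : derivative F ≠ 0) (hp : p ≠ 1) : 2 ≤ δ := by
  rcases le_or_gt 2 δ with h | hlt
  · exact h
  · exfalso
    have hδ0 : δ = 0 := by
      rcases Nat.eq_zero_or_pos δ with h0 | h0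
      · exact h0
      · exfalso
        have h1 : δ = 1 := by omega
        exact hp (Nat.dvd_one.mp (h1 ▸ hδ))
    apply hF'
    rw [hδ0, Nat.le_zero] at hF
    rw [eq_C_of_natDegree_eq_zero hF, derivative_C]

/-! ## §3 Pairwise coprime divisors: the weighted degree count -/

/-- **`Σ k_i · deg π_i ≤ deg H`** whenever the `π_i` are pairwise coprime, `π_i^{k_i} ∣ H` and `H ≠ 0` (over a field; the product of the prime powers
divides `H`). [folklore] -/
theorem births_sum_mul_natDegree_le_natDegree {K : Type*} [Field K] {ι : Type*} (s : Finset ι) (π : ι → K[X]) (k : ι → ℕ)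
    (hcop : (s : Set ι).Pairwise (Function.onFun IsCoprime π)) {H : K[X]} (hH : H ≠ 0) (hdvd : ∀ i ∈ s, π i ^ k i ∣ H) :
    ∑ i ∈ s, k i * (π i).natDegree ≤ H.natDegree := by
  have hcop' : (s : Set ι).Pairwise (Function.onFun IsCoprime fun i => π i ^ k i) :=
    fun i hi j hj hij => (hcop hi hj hij).pow
  have hprod : ∏ i ∈ s, π i ^ k i ∣ H := Finset.prod_dvd_of_coprime hcop' hdvd
  have hne : ∀ i ∈ s, π i ^ k i ≠ 0 := by
    intro i hi h0
    apply hH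
    have hzero : ∏ j ∈ s, π j ^ k j = 0 := Finset.prod_eq_zero hi h0
    rw [hzero] at hprod
    exact zero_dvd_iff.mp hprod
  calc ∑ i ∈ s, k i * (π i).natDegree = ∑ i ∈ s, (π i ^ k i).natDegree := by
        refine Finset.sum_congr rfl fun i _ => ?_
        rw [natDegree_pow]
    _ = (∏ i ∈ s, π i ^ k i).natDegree := (natDegree_prod _ _ hne).symm
    _ ≤ H.natDegree := natDegree_le_of_dvd hprod hH

/-! ## §4 The count: births weighted by `ν − 1` and residue degree number at most `δ − 2` -/

/-- **THE DEGREE COUNT OF THE δ-DESCENT** (memo 4e §2.5 «`Σ_{births c'} (r*(c') − 1)·[κ(c'):κ(c)] ≤ δ − 2`», §2.6 (c) «`Σ_{c'} ord_{c'}(λ')·[κ(c'):κ(c)]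
≤ deg λ' ≤ δ − 2`»): `K` of characteristic `p`, `p ∣ δ`, `F ∈ K[u]` of degree `≤ δ` with `F' ≠ 0`; for any family of pairwise coprime `π_i` and
exponents `n_i` with `π_i^{n_i} ∣ F − G_i^p`, `Σ_i (n_i − 1)·deg π_i ≤ δ − 2`. [folklore] -/
theorem births_weighted_count_le {K : Type*} [Field K] (p : ℕ) [CharP K p] {δ : ℕ} (hδ : p ∣ δ)
    {F : K[X]} (hF : F.natDegree ≤ δ) (hF' : derivative F ≠ 0)
    {ι : Type*} (s : Finset ι) (π : ι → K[X]) (hcop : (s : Set ι).Pairwise (Function.onFun IsCoprime π))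
    (n : ι → ℕ) (G : ι → K[X]) (hdvd : ∀ i ∈ s, π i ^ n i ∣ F - G i ^ p) :
    ∑ i ∈ s, (n i - 1) * (π i).natDegree ≤ δ - 2 := by
  refine le_trans (births_sum_mul_natDegree_le_natDegree s π (fun i => n i - 1) hcop hF' fun i hi => ?_)
    (births_natDegree_derivative_le p hδ hF)
  rcases Nat.eq_zero_or_pos (n i) with h0 | hpos
  · simp [h0]
  · obtain ⟨m, hm⟩ : ∃ m, n i = m + 1 := ⟨n i - 1, by omega⟩
    have h := hdvd i hi
    rw [hm] at h
    show π i ^ (n i - 1) ∣ derivative F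
    rw [hm, Nat.add_sub_cancel]
    exact births_pow_dvd_derivative_of_pow_succ_dvd_sub_pow p h

/-- **THE DESCENT `δ*(c') < δ*(c)`** (memo 4e §2.5: «`δ*(c') ≤ r*(c') ≤ δ*(c) − 1`»; §2.6 (c): «`δ*(c') ≤ δ*(c) − 1` for every birth, for every residue
field — whenever `λ ∉ κ(c)[u^p]`»): with `F` as above and `π` of positive degree, `π^n ∣ F − G^p` forces `n ≤ δ − 1`. [folklore] -/
theorem births_le_pred_of_pow_dvd_sub_pow {K : Type*} [Field K] (p : ℕ) [CharP K p] {δ : ℕ} (hδ : p ∣ δ)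
    {F : K[X]} (hF : F.natDegree ≤ δ) (hF' : derivative F ≠ 0)
    {π G : K[X]} (hπ : 0 < π.natDegree) {n : ℕ} (hn : π ^ n ∣ F - G ^ p) : n ≤ δ - 1 := by
  have h := births_weighted_count_le p hδ hF hF' ({()} : Finset Unit) (fun _ => π)
    (by simp [Set.Pairwise]) (fun _ => n) (fun _ => G) (fun _ _ => hn)
  rw [Finset.sum_singleton] at h
  have h1 : n - 1 ≤ δ - 2 := le_trans (Nat.le_mul_of_pos_right _ hπ) h
  have h2 : 2 ≤ δ := births_two_le_of_derivative_ne_zero p hδ hF hF' (CharP.char_ne_one K p)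
  omega

/-- The strict form `n < δ` of the descent. [folklore] -/
theorem births_lt_of_pow_dvd_sub_pow {K : Type*} [Field K] (p : ℕ) [CharP K p] {δ : ℕ} (hδ : p ∣ δ)
    {F : K[X]} (hF : F.natDegree ≤ δ) (hF' : derivative F ≠ 0)
    {π G : K[X]} (hπ : 0 < π.natDegree) {n : ℕ} (hn : π ^ n ∣ F - G ^ p) : n < δ := by
  have h2 : 2 ≤ δ := births_two_le_of_derivative_ne_zero p hδ hF hF' (CharP.char_ne_one K p)
  have h := births_le_pred_of_pow_dvd_sub_pow p hδ hF hF' hπ hn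
  omega

/-- **At most `δ − 2` births, counted with residue degrees**: the indices `i` with `2 ≤ n_i` (births: `ν ≥ 2`) satisfy `Σ deg π_i ≤ δ − 2`; in
particular (each `deg π_i ≥ 1`) there are at most `δ − 2` of them (memo 4e §2.5: «the number of births (with weights) is `≤ δ − 2`»). [folklore] -/
theorem births_card_le {K : Type*} [Field K] (p : ℕ) [CharP K p] {δ : ℕ} (hδ : p ∣ δ)
    {F : K[X]} (hF : F.natDegree ≤ δ) (hF' : derivative F ≠ 0)
    {ι : Type*} (s : Finset ι) (π : ι → K[X]) (hcop : (s : Set ι).Pairwise (Function.onFun IsCoprime π))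
    (hπ : ∀ i ∈ s, 0 < (π i).natDegree)
    (n : ι → ℕ) (G : ι → K[X]) (hdvd : ∀ i ∈ s, π i ^ n i ∣ F - G i ^ p) :
    ∑ i ∈ s.filter (fun i => 2 ≤ n i), (π i).natDegree ≤ δ - 2 ∧ (s.filter fun i => 2 ≤ n i).card ≤ δ - 2 := by
  have hcount := births_weighted_count_le p hδ hF hF' s π hcop n G hdvd
  have hsum : ∑ i ∈ s.filter (fun i => 2 ≤ n i), (π i).natDegree ≤ ∑ i ∈ s, (n i - 1) * (π i).natDegree := by
    calc ∑ i ∈ s.filter (fun i => 2 ≤ n i), (π i).natDegree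
        ≤ ∑ i ∈ s.filter (fun i => 2 ≤ n i), (n i - 1) * (π i).natDegree := by
          refine Finset.sum_le_sum fun i hi => ?_
          have h2 := (Finset.mem_filter.mp hi).2
          exact Nat.le_mul_of_pos_left _ (by omega)
      _ ≤ ∑ i ∈ s, (n i - 1) * (π i).natDegree :=
          Finset.sum_le_sum_of_subset_of_nonneg (Finset.filter_subset _ _) fun _ _ _ => Nat.zero_le _
  refine ⟨hsum.trans hcount, ?_⟩
  calc (s.filter fun i => 2 ≤ n i).card = ∑ i ∈ s.filter (fun i => 2 ≤ n i), 1 := Finset.card_eq_sum_ones _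
    _ ≤ ∑ i ∈ s.filter (fun i => 2 ≤ n i), (π i).natDegree :=
        Finset.sum_le_sum fun i hi => hπ i (Finset.mem_filter.mp hi).1
    _ ≤ δ - 2 := hsum.trans hcount

/-! ## §5 The (B2) count on a near line: tangency points of a unit monomial in linear forms -/

/-- The derivative of a power `l^{a}`, `a ≥ 1`, of a linear form `l = β u + γ`: `(l^a)' = a β · l^{a−1}`. [folklore] -/
theorem births_derivative_linear_pow {K : Type*} [CommRing K] (β γ : K) {a : ℕ} (ha : 1 ≤ a) :
    derivative ((C β * X + C γ) ^ a) = C ((a : K) * β) * (C β * X + C γ) ^ (a - 1) := by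
  obtain ⟨b, rfl⟩ : ∃ b, a = b + 1 := ⟨a - 1, by omega⟩
  rw [derivative_pow_succ, derivative_add, derivative_C_mul_X, derivative_C, add_zero, Nat.add_sub_cancel, map_mul,
    Nat.cast_succ]
  ring

/-- **`(∏ l_i^{a_i})' = N · ∏ l_i^{a_i − 1}`** with the LOG-NUMERATOR `N = Σ_i a_i β_i ∏_{j ≠ i} l_j`, for linear forms `l_i = β_i u + γ_i` and exponents
`a_i ≥ 1` (memo 4e §2.4 (B2): «`(U|_ℓ)'/U|_ℓ = Σ a_i β_i/(β_i t + γ_i)`»). [folklore] -/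
theorem births_derivative_prod_linear_pow {K : Type*} [CommRing K] {ι : Type*} [DecidableEq ι] (s : Finset ι) (β γ : ι → K)
    (a : ι → ℕ) (ha : ∀ i ∈ s, 1 ≤ a i) :
    derivative (∏ i ∈ s, (C (β i) * X + C (γ i)) ^ a i) =
      (∑ i ∈ s, C ((a i : K) * β i) * ∏ j ∈ s.erase i, (C (β j) * X + C (γ j))) *
        ∏ i ∈ s, (C (β i) * X + C (γ i)) ^ (a i - 1) := by
  rw [derivative_prod_finset, Finset.sum_mul]
  refine Finset.sum_congr rfl fun i hi => ?_
  rw [births_derivative_linear_pow (β i) (γ i) (ha i hi)]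
  -- split `∏_{j ≠ i} l_j^{a_j} = ∏_{j ≠ i} l_j · ∏_{j ≠ i} l_j^{a_j - 1}` and reinsert the factor `l_i^{a_i - 1}`
  have hsplit : ∏ j ∈ s.erase i, (C (β j) * X + C (γ j)) ^ a j =
      (∏ j ∈ s.erase i, (C (β j) * X + C (γ j))) * ∏ j ∈ s.erase i, (C (β j) * X + C (γ j)) ^ (a j - 1) := by
    rw [← Finset.prod_mul_distrib]
    refine Finset.prod_congr rfl fun j hj => ?_
    rw [← pow_succ', Nat.sub_add_cancel (ha j (Finset.mem_of_mem_erase hj))]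
  have hins : ∏ j ∈ s, (C (β j) * X + C (γ j)) ^ (a j - 1) =
      (∏ j ∈ s.erase i, (C (β j) * X + C (γ j)) ^ (a j - 1)) * (C (β i) * X + C (γ i)) ^ (a i - 1) :=
    (Finset.prod_erase_mul s (fun j => (C (β j) * X + C (γ j)) ^ (a j - 1)) hi).symm
  rw [hsplit, hins]
  ring

/-- Each summand of the log-numerator has degree `≤ |s| − 1`. [folklore] -/
theorem births_natDegree_logSummand_le {K : Type*} [CommRing K] {ι : Type*} [DecidableEq ι] (s : Finset ι) (β γ : ι → K)
    (a : ι → ℕ) {i : ι} (hi : i ∈ s) :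
    (C ((a i : K) * β i) * ∏ j ∈ s.erase i, (C (β j) * X + C (γ j))).natDegree ≤ s.card - 1 := by
  refine (natDegree_C_mul_le _ _).trans ((natDegree_prod_le _ _).trans ?_)
  rw [← Finset.card_erase_of_mem hi, Finset.card_eq_sum_ones (s.erase i)]
  exact Finset.sum_le_sum fun j _ => natDegree_linear_le (a := β j) (b := γ j)

/-- The top coefficient of a summand of the log-numerator: `coeff_{|s|−1} (a_i β_i ∏_{j ≠ i} l_j) = a_i β_i ∏_{j ≠ i} β_j`. [folklore] -/
theorem births_coeff_logSummand {K : Type*} [CommRing K] {ι : Type*} [DecidableEq ι] (s : Finset ι) (β γ : ι → K)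
    (a : ι → ℕ) {i : ι} (hi : i ∈ s) :
    (C ((a i : K) * β i) * ∏ j ∈ s.erase i, (C (β j) * X + C (γ j))).coeff (s.card - 1) =
      (a i : K) * β i * ∏ j ∈ s.erase i, β j := by
  rw [coeff_C_mul]
  congr 1
  have h := coeff_prod_of_natDegree_le (s := s.erase i) (fun j => C (β j) * X + C (γ j)) 1
    (fun j _ => natDegree_linear_le (a := β j) (b := γ j))
  rw [mul_one, Finset.card_erase_of_mem hi] at h
  rw [h]
  refine Finset.prod_congr rfl fun j _ => ?_
  show (C (β j) * X + C (γ j)).coeff 1 = β j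
  rw [coeff_add, coeff_C_mul, coeff_X_one, mul_one, coeff_C_of_ne_zero one_ne_zero, add_zero]

/-- **`deg N ≤ r − 2` when `p ∣ Σ a_i`** (memo 4e §2.4 (B2): «the numerator has degree `≤ r − 2` (the leading coefficient is `(Σ a_i)∏β_i = 0`)»):
the log-numerator of `∏_{i ∈ s} l_i^{a_i}` over `r = |s|` linear forms has degree at most `r − 2` in characteristic `p` as soon as `p ∣ Σ_i a_i`.
Hence a unit monomial in the `r` charged sides through `x` has at most `r − 2` tangency points with the foliation along a line `ℓ ⊂ E_x` off the
sides (none for `r ≤ 2`), unless `N = 0` (`ℓ` is `W`-invariant). [folklore] -/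
theorem births_natDegree_logNumerator_le {K : Type*} [CommRing K] (p : ℕ) [CharP K p] {ι : Type*} [DecidableEq ι] (s : Finset ι)
    (β γ : ι → K) (a : ι → ℕ) (hsum : p ∣ ∑ i ∈ s, a i) :
    (∑ i ∈ s, C ((a i : K) * β i) * ∏ j ∈ s.erase i, (C (β j) * X + C (γ j))).natDegree ≤ s.card - 2 := by
  rw [natDegree_le_iff_coeff_eq_zero]
  intro N hN
  rw [finsetSum_coeff]
  by_cases hlt : s.card - 1 < N
  · refine Finset.sum_eq_zero fun i hi => ?_
    exact coeff_eq_zero_of_natDegree_lt ((births_natDegree_logSummand_le s β γ a hi).trans_lt hlt)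
  · have hN1 : N = s.card - 1 := by omega
    subst hN1
    rw [Finset.sum_congr rfl fun i hi => births_coeff_logSummand s β γ a hi]
    -- `Σ_i a_i β_i ∏_{j ≠ i} β_j = (Σ_i a_i) ∏_j β_j = 0`
    have hkey : ∀ i ∈ s, (a i : K) * β i * ∏ j ∈ s.erase i, β j = (a i : K) * ∏ j ∈ s, β j := by
      intro i hi
      rw [mul_assoc, Finset.mul_prod_erase s β hi]
    rw [Finset.sum_congr rfl hkey, ← Finset.sum_mul, ← Nat.cast_sum, (CharP.cast_eq_zero_iff K p _).mpr hsum, zero_mul]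

end Summit.ResolutionOfSingularities.ResolutionOfSingularities.Theorems.RadicialJung.CleanModels
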